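import Summits.RiemannHypothesis.RiemannHypothesis.Theorems.SigmaLW0Tables
import Summits.RiemannHypothesis.RiemannHypothesis.Theorems.SigmaLW0BandSound
import Summits.RiemannHypothesis.RiemannHypothesis.Theorems.SigmaLW0Box
import Summits.RiemannHypothesis.RiemannHypothesis.Theorems.SigmaLW0Turing
import Summits.RiemannHypothesis.RiemannHypothesis.Theorems.SigmaLW0Data
import Summits.RiemannHypothesis.RiemannHypothesis.Theorems.SigmaLWindow
import HarnessLib

/-!
# SigmaL / BC5 rung W0 — the window certificate checker `certW0` and its soundness

Route `RiemannHypothesis/HardyZLehmerSplit`, item `SigmaL` (stmt-RiemannHypothesis-24253), tribunal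
seat `rh-trib-w-sigmaL-1`. COMPUTATIONAL SUPPORT ONLY: nothing here bears on the truth of RH; the
theorem `WinCert.onLine_of_check` / `onLineW0_of_check` is RH-free and says only "IF the Boolean checker returns `true` THEN every
zero of `ζ` with ordinate in `(H₀ + 19, H₀ + 40)` has real part `½`" (`H₀ = 3 000 175 332 800`).
`Theorems/SigmaLOnLineW0.lean` runs the checker `w0.check` (`native_decide`).

The checker: tables `mkRSTablesF` at scale `2^80` (main sum, `N = 691 008 ≤ 691 010` terms) and
`2^112` (Turing inequalities); band moments `bandMoments` (684 blocks, `J = 8` Taylor terms) centred at `ctrP/2^12`;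
three runs of alternating CERTIFIED signs of `Z` (`checkRunB`: each sign by `signBand` =
`bandW` + `hardyZBoxW`, soundness `mem_bandW` + `mem_hardyZBoxW`, sharp PROVED Gabcke remainder, no
named fact): the window run (89 sign changes in `[T₁, T₂]`), the upper Turing run in `[T₂, T₂+5]`,
the lower Turing run in `[T₁−5, T₁]`; the two Turing inequalities with Trudgian's PROVED constant
(`checkUpWith`, `checkLowWith`, soundness `zetaZeroCount_window_le_of_runs`) giving
`N(T₂) ≤ 12363153437308` and `12363153437218 < N(T₁)`, hence `N(T₂) ≤ N(T₁) + 89`; and the windowed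
Brent criterion `onLine_of_window_certificate`.

[cite: Brent1979, Thm 3.2 and §4]; [cite: Gabcke1979, Satz 3.2.2 p. 55]; [cite: Trudgian2011, Thm 2.2].
-/

set_option linter.dupNamespace false
set_option autoImplicit false

open Finset Complex
open Literature.Analysis.ValidatedNumerics Literature.Analysis.ValidatedNumerics.NumericsMP
open Literature.NumberTheory.LFunctions Literature.NumberTheory.LFunctions.ZetaNumerics
open Literature.NumberTheory.LFunctions.RSEval Literature.NumberTheory.LFunctions.RSCert
open scoped Real

namespace Summit.RiemannHypothesis.RiemannHypothesis.Theorems.SigmaLCert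

/-! ## 1. Certified signs from the banded evaluator, and runs -/

/-- The certified sign of `Z(p/2^E)` from the band moments `D` centred at `p₀/2^E`
(`δ = (p − p₀)/2^E`, `W = bandW …`, then `signW`). [cite: Gabcke1979, Satz 3.2.2 p. 55] -/
def signBand (R : RSTables) (E N p0 J : ℕ) (D : List (MI × List MC × MI × ℤ)) (p : ℕ) : Option Bool :=
  match bandW R (MI.ofFrac R.T.S ((p : ℤ) - p0) (2 ^ E)) J D with
  | some W => signW R p E N W
  | none => none

/-- Soundness of `signBand`. [cite: Gabcke1979, Satz 3.2.2 p. 55] -/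
theorem sgnZ_of_signBand {R : RSTables} (hR : R.Valid) {E N p0 J : ℕ} {sizes : List ℕ}
    {D : List (MI × List MC × MI × ℤ)} (hsum : sizes.sum = N) (hN : N ≤ R.T.N)
    (hD : bandMoments R (MI.ofFrac R.T.S (p0 : ℤ) (2 ^ E)) J 1 sizes = some D) {p : ℕ} {b : Bool}
    (h : signBand R E N p0 J D p = some b) : sgnZ E p b := by
  unfold signBand at h
  split at h
  · rename_i W hW
    have ht : MI.mem R.T.S ((p0 : ℝ) / 2 ^ E) (MI.ofFrac R.T.S (p0 : ℤ) (2 ^ E)) := by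
      have := MI.mem_ofFrac R.T.S (p0 : ℤ) (q := 2 ^ E) (by positivity)
      have e1 : (((p0 : ℤ) : ℝ)) / ((2 ^ E : ℕ) : ℝ) = (p0 : ℝ) / 2 ^ E := by push_cast; ring
      rwa [e1] at this
    have hδ : MI.mem R.T.S ((((p : ℤ) - p0 : ℤ) : ℝ) / 2 ^ E)
        (MI.ofFrac R.T.S ((p : ℤ) - p0) (2 ^ E)) := by
      have := MI.mem_ofFrac R.T.S ((p : ℤ) - p0) (q := 2 ^ E) (by positivity)
      have e1 : ((((p : ℤ) - p0 : ℤ) : ℝ)) / ((2 ^ E : ℕ) : ℝ) = (((p : ℤ) - p0 : ℤ) : ℝ) / 2 ^ E := by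
        push_cast; ring
      rwa [e1] at this
    have hmem := mem_bandW hR ht hδ hsum hN hD hW
    have e : (p0 : ℝ) / 2 ^ E + (((p : ℤ) - p0 : ℤ) : ℝ) / 2 ^ E = (p : ℝ) / 2 ^ E := by
      push_cast; ring
    rw [e] at hmem
    exact sgnZ_of_signW hR hmem h
  · simp at h

/-- Check the gaps of a run: positive gaps and alternating certified signs after the first point.
[cite: Brent1979, §3] -/
def checkGapsB (R : RSTables) (E N p0 J : ℕ) (D : List (MI × List MC × MI × ℤ)) :
    ℕ → Bool → List ℕ → Bool
  | _, _, [] => true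
  | p, s, g :: gs =>
    if 0 < g ∧ signBand R E N p0 J D (p + g) = some (!s) then checkGapsB R E N p0 J D (p + g) (!s) gs
    else false

/-- Check a whole run: the certified sign at the first point, then `checkGapsB`. [cite: Brent1979, §3] -/
def checkRunB (R : RSTables) (E N p0 J : ℕ) (D : List (MI × List MC × MI × ℤ)) (p : ℕ) (s : Bool)
    (gs : List ℕ) : Bool :=
  if signBand R E N p0 J D p = some s then checkGapsB R E N p0 J D p s gs else false

/-- Soundness of `checkGapsB`: an `RSCert.AltRun`. [cite: Brent1979, §3] -/
theorem altRun_of_checkGapsB {R : RSTables} (hR : R.Valid) {E N p0 J : ℕ} {sizes : List ℕ}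
    {D : List (MI × List MC × MI × ℤ)} (hsum : sizes.sum = N) (hN : N ≤ R.T.N)
    (hD : bandMoments R (MI.ofFrac R.T.S (p0 : ℤ) (2 ^ E)) J 1 sizes = some D) :
    ∀ (gs : List ℕ) (p : ℕ) (s : Bool), sgnZ E p s → checkGapsB R E N p0 J D p s gs = true →
      AltRun E p s gs
  | [], p, s, hp, _ => hp
  | g :: gs, p, s, hp, h => by
    simp only [checkGapsB] at h
    split_ifs at h with hc
    obtain ⟨hg, hsg⟩ := hc
    exact ⟨hp, hg, altRun_of_checkGapsB hR hsum hN hD gs (p + g) (!s)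
      (sgnZ_of_signBand hR hsum hN hD hsg) h⟩

/-- Soundness of `checkRunB`. [cite: Brent1979, §3] -/
theorem altRun_of_checkRunB {R : RSTables} (hR : R.Valid) {E N p0 J : ℕ} {sizes : List ℕ}
    {D : List (MI × List MC × MI × ℤ)} (hsum : sizes.sum = N) (hN : N ≤ R.T.N)
    (hD : bandMoments R (MI.ofFrac R.T.S (p0 : ℤ) (2 ^ E)) J 1 sizes = some D) {gs : List ℕ}
    {p : ℕ} {s : Bool} (h : checkRunB R E N p0 J D p s gs = true) : AltRun E p s gs := by
  unfold checkRunB at h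
  split_ifs at h with hc
  exact altRun_of_checkGapsB hR hsum hN hD gs p s (sgnZ_of_signBand hR hsum hN hD hc) h

/-! ## 2. A generic window certificate and its soundness -/

/-- The data of a window certificate (every field an untrusted natural number / list; the checker
re-verifies everything). Heights in units of `1`, grid points in units of `2^-E`.
[cite: Brent1979, Thm 3.2 and §4] -/
structure WinCert where
  /-- scale of the main-sum tables -/
  S : ℕ
  /-- table length (≥ the main-sum length `N`) -/
  NT : ℕ
  /-- main-sum length on the whole height range -/
  N : ℕ
  /-- `mkRSTablesF` precision knobs: guard, bits, Kpi, Kexp, kexp, KI, kI, KlogT -/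
  guard : ℕ
  bits : ℕ
  Kpi : ℕ
  Kexp : ℕ
  kexp : ℕ
  KI : ℕ
  kI : ℕ
  KlogT : ℕ
  /-- scale / bits / Kpi / KlogT of the high-precision tables for the Turing inequalities -/
  Sθ : ℕ
  bitsθ : ℕ
  Kpiθ : ℕ
  KlogTθ : ℕ
  /-- grid exponent, band centre (grid units), Taylor order, band block sizes -/
  E : ℕ
  p0 : ℕ
  J : ℕ
  sizes : List ℕ
  /-- the window `[T1, T2]`, Turing buffer `h`, claimed counts `n1 < N(T1)`, `N(T2) ≤ n2` -/
  T1 : ℕ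
  T2 : ℕ
  h : ℕ
  n1 : ℕ
  n2 : ℕ
  /-- the three runs: start point, start sign, gaps -/
  winStart : ℕ
  winSign : Bool
  winGaps : List ℕ
  upStart : ℕ
  upSign : Bool
  upGaps : List ℕ
  lowStart : ℕ
  lowSign : Bool
  lowGaps : List ℕ

/-- **The window certificate checker** (one Boolean): tables, band moments, three runs of alternating
certified signs of `Z`, the two Turing inequalities, and the structural arithmetic.
[cite: Brent1979, Thm 3.2 and §4] -/
def WinCert.check (c : WinCert) : Bool :=
  match mkRSTablesF c.S c.NT c.guard c.bits c.Kpi c.Kexp c.kexp c.KI c.kI c.KlogT,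
    mkRSTablesF c.Sθ 2 c.guard c.bitsθ c.Kpiθ c.Kexp c.kexp c.KI c.kI c.KlogTθ with
  | some R, some Rθ =>
    match bandMoments R (MI.ofFrac R.T.S (c.p0 : ℤ) (2 ^ c.E)) c.J 1 c.sizes with
    | some D =>
      decide (c.N ≤ R.T.N) &&
      checkRunB R c.E c.N c.p0 c.J D c.winStart c.winSign c.winGaps &&
      checkRunB R c.E c.N c.p0 c.J D c.upStart c.upSign c.upGaps &&
      checkRunB R c.E c.N c.p0 c.J D c.lowStart c.lowSign c.lowGaps &&
      checkUpWith Rθ c.E c.T2 c.h c.n2 c.upStart c.upGaps &&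
      checkLowWith Rθ c.E (c.T1 - c.h) c.h c.n1 c.lowStart c.lowGaps &&
      decide (c.sizes.sum = c.N) &&
      decide (c.T1 * 2 ^ c.E ≤ c.winStart) &&
      decide (c.winStart + c.winGaps.sum ≤ c.T2 * 2 ^ c.E) &&
      decide (c.T2 * 2 ^ c.E ≤ c.upStart) &&
      decide (c.upStart + c.upGaps.sum ≤ (c.T2 + c.h) * 2 ^ c.E) &&
      decide ((c.T1 - c.h) * 2 ^ c.E ≤ c.lowStart) &&
      decide (c.lowStart + c.lowGaps.sum ≤ c.T1 * 2 ^ c.E) &&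
      decide (c.n2 ≤ c.n1 + 1 + c.winGaps.length) &&
      decide (0 < c.h) && decide (528 + c.h + c.h ≤ c.T1) && decide (c.T1 ≤ c.T2)
    | none => false
  | _, _ => false

/-- **Soundness of the window certificate (RH-free):** if `c.check = true` then every zero of `ζ`
with ordinate in `(T1, T2)` has real part `½`. (Three `AltRun`s from the certified signs; the Turing
inequalities give `N(T2) ≤ n2` and `n1 < N(T1)`, so `N(T2) ≤ N(T1) + m` with `m` the number of sign
changes of the window run; then the windowed Brent criterion.) Nothing here bears on the truth of RH.
[cite: Brent1979, Thm 3.2 and §4] -/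
theorem WinCert.onLine_of_check (c : WinCert) (hc : c.check = true) :
    ∀ ρ : ℂ, riemannZeta ρ = 0 → (c.T1 : ℝ) < ρ.im → ρ.im < (c.T2 : ℝ) → ρ.re = 1 / 2 := by
  unfold WinCert.check at hc
  split at hc
  · rename_i R Rθ hR hRθ
    split at hc
    · rename_i D hD
      simp only [Bool.and_eq_true, decide_eq_true_eq] at hc
      obtain ⟨⟨⟨⟨⟨⟨⟨⟨⟨⟨⟨⟨⟨⟨⟨⟨hN, hwin⟩, hup⟩, hlow⟩, hcu⟩, hcl⟩, hsum⟩, hw0⟩, hw1⟩, hu0⟩, hu1⟩,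
        hl0⟩, hl1⟩, hcount⟩, hh⟩, hT1⟩, hT12⟩ := hc
      have hRv := mkRSTablesF_valid hR
      have hRθv := mkRSTablesF_valid hRθ
      have hrunW := altRun_of_checkRunB hRv hsum hN hD hwin
      have hrunU := altRun_of_checkRunB hRv hsum hN hD hup
      have hrunL := altRun_of_checkRunB hRv hsum hN hD hlow
      have hcnt := zetaZeroCount_window_le_of_runs hRθv hrunU hu0 hu1 hrunL hl0 hl1 hh
        (by omega) hT12 hcu hcl
      obtain ⟨sv, hs, hs0, hsm, hssign, -⟩ :=
        exists_fin_of_altRun c.winGaps c.winStart c.winSign hrunW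
      have h2e : (0 : ℝ) < 2 ^ c.E := by positivity
      refine onLine_of_window_certificate (by positivity) sv hs ?_ ?_ hssign ?_
      · rw [hs0, le_div_iff₀ h2e]; exact_mod_cast hw0
      · rw [hsm, div_le_iff₀ h2e]; exact_mod_cast hw1
      · omega
    · simp at hc
  · simp at hc

/-! ## 3. The certificate for the window `W0 = (H₀ + 19, H₀ + 40)`, `H₀ = 3 000 175 332 800` -/

/-- The certificate data for `W0` (kit job of record j332208; `Theorems/SigmaLW0Data.lean`): main-sum
tables at `2^80` for `691 010 ≥ N = 691 008` terms, Turing tables at `2^112`, grid `2^-12`, `J = 8`,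
`h = 5`, `n1 = 12363153437218`, `n2 = 12363153437308`. [cite: Brent1979, Thm 3.2 and §4] -/
def w0 : WinCert where
  S := 2 ^ 80
  NT := 691010
  N := 691008
  guard := 24
  bits := 104
  Kpi := 26
  Kexp := 14
  kexp := 8
  KI := 14
  kI := 6
  KlogT := 110
  Sθ := 2 ^ 112
  bitsθ := 136
  Kpiθ := 36
  KlogTθ := 130
  E := 12
  p0 := ctrP
  J := 8
  sizes := bandSizes
  T1 := 3000175332819
  T2 := 3000175332840
  h := 5
  n1 := 12363153437218
  n2 := 12363153437308
  winStart := winStart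
  winSign := winSign
  winGaps := winGaps
  upStart := upStart
  upSign := upSign
  upGaps := upGaps
  lowStart := lowStart
  lowSign := lowSign
  lowGaps := lowGaps

/-- **Soundness for `W0` (RH-free):** if `w0.check = true` then every zero of `ζ` with ordinate in
`(H₀ + 19, H₀ + 40)` has real part `½`. `Theorems/SigmaLOnLineW0.lean` evaluates `w0.check` by
`native_decide`. Nothing here bears on the truth of RH. [cite: Brent1979, Thm 3.2 and §4] -/
theorem onLineW0_of_check (hc : w0.check = true) :
    ∀ ρ : ℂ, riemannZeta ρ = 0 → 3000175332819 < ρ.im → ρ.im < 3000175332840 → ρ.re = 1 / 2 :=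
  w0.onLine_of_check hc

end Summit.RiemannHypothesis.RiemannHypothesis.Theorems.SigmaLCert
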